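import Summits.Ventures.PercRepro.RankLevelSetUpResidue

/-! # RankLevelSetUpClassCutDecomp — THE EXACT DECOMPOSITION OF `T_4` AND `V_5` ALONG A PARALLEL CLASS, BOTH
DIRECTIONS, AND THE SMALL COMPLEMENTS (night-1 g39; dossier §51; on `RankLevelSetUpResidue`)

For a loopless rank-`4` matroid `N`, `P = cl {p}` of size `q` and `b ∉ P`, the through-`b` bi-spanning `4`-sets and
the avoid-`b` bi-spanning `5`-sets sort by `#(W ∩ P)`: `through_four_le` (`RankLevelSetUpSeriesClass`) gave
`T_4 ≤ A_4 + q · g_3`; here **`through_four_ge`** gives `A_4 + q · g_3 ≤ T_4` (for `q ≥ 2`), and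
**`avoid_five_le`** gives `V_5 ≤ Ā_5 + q · ḡ_4 + C(q,2) · ḡ_3` (for every `q`; a spanning `5`-set contains no three
parallel elements, **`not_three_parallel_of_spanning_five`**), the converse of `avoid_five_ge`. The dictionary
**`spanning_insert_of_spanning_union`** absorbs any subset of `cl {p}` into `p`. The small complements:
**`upFull_four_eq_empty_of_le_six`** (`A_4 = ∅` for `#E' ≤ 6`) and **`upFull_four_le_avoidHat_three_of_seven`**
(`A_4 ≤ ḡ_3` for `#E' = 7`, by `W ↦ E' ∖ W`). These are the ingredients of the class-cut reduction
(`RankLevelSetUpClassCut`). Every declaration has a docstring; imports: the cell's own modules and Mathlib only.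
Axioms: standard. -/

namespace PercRepro

open Set Matroid

variable {α : Type}

/-! ## Spanning through the closure of `p` -/

/-- **Absorbing a subset of `cl {p}` into `p`**: if `X ∪ S` spans and `S ⊆ cl {p}`, then `insert p X` spans
(`S ⊆ cl {p} ⊆ cl (insert p X)`). No nonemptiness of `S` is needed. -/
lemma spanning_insert_of_spanning_union (N : Matroid α) {p : α} (hp : p ∈ N.E) {S X : Set α}
    (hSP : S ⊆ N.closure {p}) (hXE : X ⊆ N.E) (h : N.Spanning (X ∪ S)) : N.Spanning (insert p X) := by
  rw [Matroid.spanning_iff_closure_eq (Set.insert_subset hp hXE)]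
  refine subset_antisymm (N.closure_subset_ground _) ?_
  have h1 : X ∪ S ⊆ N.closure (insert p X) := by
    intro x hx
    rcases hx with hx | hx
    · exact N.mem_closure_of_mem' (Set.mem_insert_of_mem p hx) (hXE hx)
    · have hpX : {p} ⊆ insert p X := Set.singleton_subset_iff.mpr (Set.mem_insert p X)
      exact N.closure_subset_closure hpX (hSP hx)
  have h2 := N.closure_subset_closure_of_subset_closure h1
  rw [h.closure_eq] at h2
  exact h2

/-- **A spanning `5`-set of a rank-`4` matroid contains no three distinct parallel elements**: deleting two of
them leaves a spanning `3`-set. -/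
lemma not_three_parallel_of_spanning_five {N : Matroid α} [N.Finite] (hnl : ∀ e ∈ N.E, N.IsNonloop e)
    (hr : N.eRank = 4) {Z : Set α} (hZ : N.Spanning Z) (hZ5 : Z.ncard = 5) {p x y z : α} (hx : x ∈ Z) (hy : y ∈ Z)
    (hz : z ∈ Z) (hxy : x ≠ y) (hxz : x ≠ z) (hyz : y ≠ z) (hxP : x ∈ N.closure {p}) (hyP : y ∈ N.closure {p})
    (hzP : z ∈ N.closure {p}) : False := by
  have hZfin : Z.Finite := N.ground_finite.subset hZ.subset_ground
  have hxnl : N.IsNonloop x := hnl x (hZ.subset_ground hx)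
  have hclx : N.closure {x} = N.closure {p} := hxnl.closure_eq_of_mem_closure hxP
  have hz' : z ∈ N.closure (Z \ {z}) := by
    have : z ∈ N.closure {x} := by rw [hclx]; exact hzP
    have hxZ' : x ∈ Z \ {z} := ⟨hx, fun h => hxz (by simpa using h)⟩
    exact N.closure_subset_closure (Set.singleton_subset_iff.mpr hxZ') this
  have hsp : N.Spanning (Z \ {z}) := (spanning_sdiff_singleton_iff hZ hz).mpr hz'
  have h4 : (Z \ {z}).ncard = 4 := by rw [Set.ncard_sdiff_singleton_of_mem hz, hZ5]
  exact not_two_parallel_of_spanning_four hnl hr hsp h4 (p := p) ⟨hx, fun h => hxz (by simpa using h)⟩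
    ⟨hy, fun h => hyz (by simpa using h)⟩ hxy hxP hyP

/-! ## The exact decomposition along the class: the two missing directions -/

variable (N : Matroid α) [N.Finite]

/-- **THE THROUGH-`b` SIDE, LOWER BOUND**: `A_4 + q · g_3 ≤ T_4` when `q = #cl {p} ≥ 2` — the members of the mixed
family are bi-spanning `4`-sets disjoint from the class, and `(S, U) ↦ U ∪ S` (`#S = 1`, `U ∈ g_3`) lands in the
bi-spanning `4`-sets meeting the class in one element (the complement keeps an element of the class, hence spans). -/
theorem through_four_ge (hnl : ∀ e ∈ N.E, N.IsNonloop e) {p : α} (hp : p ∈ N.E)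
    (hq : 2 ≤ (N.closure {p}).ncard) {b : α} (_hbP : b ∉ N.closure {p}) :
    (upFull N p b 4).ncard + (N.closure {p}).ncard * (throughHat N p b 3).ncard ≤
      {W ∈ biSpan N 4 | b ∈ W}.ncard := by
  classical
  set P := N.closure {p} with hPdef
  have hPE : P ⊆ N.E := N.closure_subset_ground _
  have hpP : p ∈ P := N.mem_closure_of_mem' rfl hp
  have hpnl : N.IsNonloop p := hnl p hp
  have hPfin : P.Finite := N.ground_finite.subset hPE
  set T := {W ∈ biSpan N 4 | b ∈ W} with hT
  have hTfin : T.Finite := N.ground_finite.finite_subsets.subset (fun _ h => h.1.1)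
  let T₀ : Set (Set α) := {W ∈ T | (W ∩ P).ncard = 0}
  let T₁ : Set (Set α) := {W ∈ T | (W ∩ P).ncard = 1}
  have hT₀ : T₀ ⊆ T := fun _ h => h.1
  have hT₁ : T₁ ⊆ T := fun _ h => h.1
  have hdisj : Disjoint T₀ T₁ := by
    rw [Set.disjoint_left]
    rintro W ⟨-, h0⟩ ⟨-, h1⟩
    omega
  -- the mixed family sits in `T₀`
  have h0 : (upFull N p b 4).ncard ≤ T₀.ncard := by
    refine Set.ncard_le_ncard ?_ (hTfin.subset hT₀)
    rintro W ⟨hWE, hW4, hbW, hWs, hWc⟩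
    have hWP : W ∩ P = ∅ := inter_eq_empty_of_subset_compl N hWE
    refine ⟨⟨⟨hWE.trans Set.sdiff_subset, hW4, hWs, ?_⟩, hbW⟩, by rw [hWP, Set.ncard_empty]⟩
    rw [compl_eq_union_of_disjoint N hPE hWP]
    exact (spanning_union_iff_insert N hnl hpnl (X := (N.E \ P) \ W) (subset_refl P) ⟨p, hpP⟩
      (Set.sdiff_subset.trans Set.sdiff_subset)).mpr hWc
  -- `(S, U) ↦ U ∪ S` injects `P × g_3` into `T₁`
  have h1 : ({S | S ⊆ P ∧ S.ncard = 1} ×ˢ throughHat N p b 3).ncard ≤ T₁.ncard := by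
    refine Set.ncard_le_ncard_of_injOn (fun x => x.2 ∪ x.1) ?_ ?_ (hTfin.subset hT₁)
    · rintro ⟨S, U⟩ hx
      obtain ⟨hx1, hx2⟩ := Set.mem_prod.mp hx
      dsimp only at hx1 hx2
      obtain ⟨hSP, hS1⟩ := hx1
      obtain ⟨hUE, hU3, hbU, hUs, hUc⟩ := hx2
      simp only
      have hUfin : U.Finite := N.ground_finite.subset (hUE.trans Set.sdiff_subset)
      have hSfin : S.Finite := hPfin.subset hSP
      have hdj : Disjoint U S := by
        rw [Set.disjoint_left]
        intro x hxU hxS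
        exact (hUE hxU).2 (hSP hxS)
      have hSne : S.Nonempty := by
        rw [← Set.ncard_pos hSfin]; omega
      have hPSne : (P \ S).Nonempty := by
        by_contra hemp
        rw [Set.not_nonempty_iff_eq_empty, Set.sdiff_eq_empty] at hemp
        have := Set.ncard_le_ncard hemp hSfin
        omega
      refine ⟨⟨⟨Set.union_subset (hUE.trans Set.sdiff_subset) (hSP.trans hPE), ?_, ?_, ?_⟩, ?_⟩, ?_⟩
      · rw [Set.ncard_union_eq hdj hUfin hSfin, hU3, hS1]
      · exact (spanning_union_iff_insert N hnl hpnl hSP hSne (hUE.trans Set.sdiff_subset)).mpr hUs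
      · rw [compl_union_eq N hPE hUE hSP]
        exact (spanning_union_iff_insert N hnl hpnl Set.sdiff_subset hPSne
          (Set.sdiff_subset.trans Set.sdiff_subset)).mpr hUc
      · exact Or.inl hbU
      · have : (U ∪ S) ∩ P = S := by
          ext x
          simp only [Set.mem_inter_iff, Set.mem_union]
          constructor
          · rintro ⟨hx | hx, hxP⟩
            · exact absurd hxP (hUE hx).2
            · exact hx
          · intro hx; exact ⟨Or.inr hx, hSP hx⟩
        rw [this, hS1]
    · rintro ⟨S, U⟩ hx ⟨S', U'⟩ hx' heq
      obtain ⟨hx1, hx2⟩ := Set.mem_prod.mp hx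
      obtain ⟨hx1', hx2'⟩ := Set.mem_prod.mp hx'
      dsimp only at hx1 hx2 hx1' hx2'
      have hSP : S ⊆ P := hx1.1
      have hUE : U ⊆ N.E \ P := hx2.1
      have hS'P : S' ⊆ P := hx1'.1
      have hU'E : U' ⊆ N.E \ P := hx2'.1
      simp only at heq
      have hS : S = (U ∪ S) ∩ P := by
        ext x; simp only [Set.mem_inter_iff, Set.mem_union]
        constructor
        · intro hx; exact ⟨Or.inr hx, hSP hx⟩
        · rintro ⟨hx | hx, hxP⟩
          · exact absurd hxP (hUE hx).2
          · exact hx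
      have hS' : S' = (U' ∪ S') ∩ P := by
        ext x; simp only [Set.mem_inter_iff, Set.mem_union]
        constructor
        · intro hx; exact ⟨Or.inr hx, hS'P hx⟩
        · rintro ⟨hx | hx, hxP⟩
          · exact absurd hxP (hU'E hx).2
          · exact hx
      have hU : U = (U ∪ S) \ P := by
        ext x; simp only [Set.mem_sdiff, Set.mem_union]
        constructor
        · intro hx; exact ⟨Or.inl hx, (hUE hx).2⟩
        · rintro ⟨hx | hx, hxP⟩
          · exact hx
          · exact absurd (hSP hx) hxP
      have hU' : U' = (U' ∪ S') \ P := by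
        ext x; simp only [Set.mem_sdiff, Set.mem_union]
        constructor
        · intro hx; exact ⟨Or.inl hx, (hU'E hx).2⟩
        · rintro ⟨hx | hx, hxP⟩
          · exact hx
          · exact absurd (hS'P hx) hxP
      rw [Prod.mk.injEq]
      refine ⟨?_, ?_⟩
      · rw [hS, hS', heq]
      · rw [hU, hU', heq]
  rw [Set.ncard_prod, Set.ncard_powerset_ncard hPfin, Nat.choose_one_right] at h1
  calc (upFull N p b 4).ncard + P.ncard * (throughHat N p b 3).ncard
      ≤ T₀.ncard + T₁.ncard := Nat.add_le_add h0 h1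
    _ = (T₀ ∪ T₁).ncard := (Set.ncard_union_eq hdisj (hTfin.subset hT₀) (hTfin.subset hT₁)).symm
    _ ≤ T.ncard := Set.ncard_le_ncard (Set.union_subset hT₀ hT₁) hTfin

/-- **THE AVOID-`b` SIDE, UPPER BOUND**: `V_5 ≤ Ā_5 + q · ḡ_4 + C(q,2) · ḡ_3` for every class size — a bi-spanning
`5`-set avoiding `b` meets the class in at most two elements (`not_three_parallel_of_spanning_five`); sorted by
`#(Z ∩ P)`, the pieces inject into `Ā_5`, `P × ḡ_4` and `{pairs of P} × ḡ_3` by `Z ↦ (Z ∩ P, Z ∖ P)`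
(`spanning_insert_of_spanning_union` absorbs the class into `p` on both sides). -/
theorem avoid_five_le (hnl : ∀ e ∈ N.E, N.IsNonloop e) (hr : N.eRank = 4) {p : α} (hp : p ∈ N.E) {b : α}
    (_hbP : b ∉ N.closure {p}) :
    {Z ∈ biSpan N 5 | b ∉ Z}.ncard ≤ (avoidFull N p b 5).ncard + (N.closure {p}).ncard * (avoidHat N p b 4).ncard +
      (N.closure {p}).ncard.choose 2 * (avoidHat N p b 3).ncard := by
  classical
  set P := N.closure {p} with hPdef
  have hPE : P ⊆ N.E := N.closure_subset_ground _
  have hpP : p ∈ P := N.mem_closure_of_mem' rfl hp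
  have hPfin : P.Finite := N.ground_finite.subset hPE
  set V := {Z ∈ biSpan N 5 | b ∉ Z} with hV
  have hVfin : V.Finite := N.ground_finite.finite_subsets.subset (fun _ h => h.1.1)
  let Vk : ℕ → Set (Set α) := fun k => {Z ∈ V | (Z ∩ P).ncard = k}
  have hVk : ∀ k, Vk k ⊆ V := fun k _ h => h.1
  -- every member meets the class in at most two elements
  have hcover : V ⊆ Vk 0 ∪ Vk 1 ∪ Vk 2 := by
    intro Z hZ
    have hZ' := hZ
    obtain ⟨⟨hZE, hZ5, hZs, -⟩, -⟩ := hZ'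
    have hZfin : Z.Finite := N.ground_finite.subset hZE
    have hle : (Z ∩ P).ncard ≤ 2 := by
      by_contra hgt
      push Not at hgt
      rw [Set.two_lt_ncard (hZfin.subset Set.inter_subset_left)] at hgt
      obtain ⟨x, hx, y, hy, z, hz, hxy, hxz, hyz⟩ := hgt
      exact not_three_parallel_of_spanning_five hnl hr hZs hZ5 (p := p) hx.1 hy.1 hz.1 hxy hxz hyz hx.2 hy.2 hz.2
    rcases Nat.lt_or_ge (Z ∩ P).ncard 1 with h0 | h1
    · exact Or.inl (Or.inl ⟨hZ, by omega⟩)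
    · rcases Nat.lt_or_ge (Z ∩ P).ncard 2 with h1' | h2
      · exact Or.inl (Or.inr ⟨hZ, by omega⟩)
      · exact Or.inr ⟨hZ, by omega⟩
  -- the piece meeting the class in `s` elements, `1 ≤ s ≤ 2`, injects into `{#S = s} × ḡ_{5 - s}`
  have hinj : ∀ s : ℕ, 1 ≤ s → s ≤ 2 →
      (Vk s).ncard ≤ ({S | S ⊆ P ∧ S.ncard = s} ×ˢ avoidHat N p b (5 - s)).ncard := by
    intro s hs1 hs2
    refine Set.ncard_le_ncard_of_injOn (fun Z => (Z ∩ P, Z \ P)) ?_ ?_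
      ((hPfin.finite_subsets.subset (fun _ h => h.1)).prod (avoidHat_finite N p b (5 - s)))
    · rintro Z ⟨⟨⟨hZE, hZ5, hZs, hZc⟩, hbZ⟩, hZs'⟩
      have hZfin : Z.Finite := N.ground_finite.subset hZE
      refine ⟨⟨Set.inter_subset_right, hZs'⟩, ?_, ?_, ?_, ?_, ?_⟩
      · intro y hy; exact ⟨hZE hy.1, hy.2⟩
      · have h := Set.ncard_inter_add_ncard_sdiff_eq_ncard Z P hZfin
        rw [hZs', hZ5] at h
        show (Z \ P).ncard = 5 - s
        omega
      · exact fun h => hbZ h.1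
      · have hZ' : Z = (Z \ P) ∪ (Z ∩ P) := by rw [Set.sdiff_union_inter]
        rw [hZ'] at hZs
        exact spanning_insert_of_spanning_union N hp Set.inter_subset_right (Set.sdiff_subset.trans hZE) hZs
      · have hcompl : N.E \ Z = ((N.E \ P) \ (Z \ P)) ∪ (P \ Z) := by
          ext y
          simp only [Set.mem_sdiff, Set.mem_union, not_and, not_not]
          constructor
          · rintro ⟨hyE, hyZ⟩
            by_cases hyP : y ∈ P
            · exact Or.inr ⟨hyP, hyZ⟩
            · exact Or.inl ⟨⟨hyE, hyP⟩, fun h => absurd h hyZ⟩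
          · rintro (⟨⟨hyE, hyP⟩, h⟩ | ⟨hyP, hyZ⟩)
            · exact ⟨hyE, fun hyZ => hyP (h hyZ)⟩
            · exact ⟨hPE hyP, hyZ⟩
        rw [hcompl] at hZc
        exact spanning_insert_of_spanning_union N hp Set.sdiff_subset
          (Set.sdiff_subset.trans Set.sdiff_subset) hZc
    · intro Z _ Z' _ heq
      simp only [Prod.mk.injEq] at heq
      rw [← Set.inter_union_sdiff Z P, ← Set.inter_union_sdiff Z' P, heq.1, heq.2]
  have h0 : (Vk 0).ncard ≤ (avoidFull N p b 5).ncard := by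
    refine Set.ncard_le_ncard ?_ (avoidFull_finite N p b 5)
    rintro Z ⟨⟨⟨hZE, hZ5, hZs, hZc⟩, hbZ⟩, hZ0⟩
    have hZfin : Z.Finite := N.ground_finite.subset hZE
    have hZP : Z ∩ P = ∅ := (Set.ncard_eq_zero (hZfin.subset Set.inter_subset_left)).mp hZ0
    have hZE' : Z ⊆ N.E \ P := by
      intro x hx
      refine ⟨hZE hx, fun hxP => ?_⟩
      have : x ∈ Z ∩ P := ⟨hx, hxP⟩
      rw [hZP] at this; exact this
    refine ⟨hZE', hZ5, hbZ, hZs, ?_⟩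
    rw [compl_eq_union_of_disjoint N hPE hZP] at hZc
    exact spanning_insert_of_spanning_union N hp (subset_refl P) (Set.sdiff_subset.trans Set.sdiff_subset) hZc
  have h1 := hinj 1 le_rfl (by norm_num)
  have h2 := hinj 2 (by norm_num) le_rfl
  rw [Set.ncard_prod, Set.ncard_powerset_ncard hPfin, Nat.choose_one_right] at h1
  rw [Set.ncard_prod, Set.ncard_powerset_ncard hPfin] at h2
  have e1 : 5 - 1 = 4 := rfl
  have e2 : 5 - 2 = 3 := rfl
  rw [e1] at h1; rw [e2] at h2
  calc V.ncard ≤ (Vk 0 ∪ Vk 1 ∪ Vk 2).ncard :=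
        Set.ncard_le_ncard hcover ((hVfin.subset (hVk 0)).union (hVfin.subset (hVk 1)) |>.union (hVfin.subset (hVk 2)))
    _ ≤ (Vk 0 ∪ Vk 1).ncard + (Vk 2).ncard := Set.ncard_union_le _ _
    _ ≤ (Vk 0).ncard + (Vk 1).ncard + (Vk 2).ncard := Nat.add_le_add_right (Set.ncard_union_le _ _) _
    _ ≤ _ := by omega

/-! ## The small complements -/

/-- **`A_4` is empty when `#(E ∖ cl {p}) ≤ 6`** (`rk N = 4`): the complement of a member, together with `p`, has at
most three elements and cannot span. -/
lemma upFull_four_eq_empty_of_le_six (hr : N.eRank = 4) {p b : α} (h6 : (N.E \ N.closure {p}).ncard ≤ 6) :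
    upFull N p b 4 = ∅ := by
  set E' := N.E \ N.closure {p} with hE'
  have hE'fin : E'.Finite := N.ground_finite.subset Set.sdiff_subset
  rw [Set.eq_empty_iff_forall_notMem]
  rintro W ⟨hWE, hW4, -, -, hWc⟩
  have h1 := eRank_le_encard_of_spanning hWc
  have hfin : (insert p (E' \ W)).Finite := (hE'fin.subset Set.sdiff_subset).insert p
  rw [hr, hfin.encard_eq_coe_toFinset_card, ← Set.ncard_eq_toFinset_card _ hfin] at h1
  have h2 : (insert p (E' \ W)).ncard ≤ (E' \ W).ncard + 1 := Set.ncard_insert_le p _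
  have h3 : (E' \ W).ncard = E'.ncard - 4 := by rw [Set.ncard_sdiff hWE (hE'fin.subset hWE), hW4]
  have h4 : (4 : ℕ) ≤ (insert p (E' \ W)).ncard := by exact_mod_cast h1
  omega

/-- **`A_4 ≤ ḡ_3` when `#(E ∖ cl {p}) = 7`**: `W ↦ E' ∖ W` is an injection — the complement is a `3`-set avoiding
`b` which spans together with `p`, and whose own complement `W` spans. -/
lemma upFull_four_le_avoidHat_three_of_seven {p b : α} (hp : p ∈ N.E) (_hbP : b ∉ N.closure {p})
    (h7 : (N.E \ N.closure {p}).ncard = 7) : (upFull N p b 4).ncard ≤ (avoidHat N p b 3).ncard := by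
  set E' := N.E \ N.closure {p} with hE'
  have hE'fin : E'.Finite := N.ground_finite.subset Set.sdiff_subset
  refine Set.ncard_le_ncard_of_injOn (fun W => E' \ W) ?_ ?_ (avoidHat_finite N p b 3)
  · rintro W ⟨hWE, hW4, hbW, hWs, hWc⟩
    refine ⟨Set.sdiff_subset, ?_, fun h => h.2 hbW, hWc, ?_⟩
    · rw [Set.ncard_sdiff hWE (hE'fin.subset hWE), hW4, h7]
    · rw [Set.sdiff_sdiff_cancel_left hWE]
      exact hWs.superset (Set.subset_insert p W) (Set.insert_subset hp hWs.subset_ground)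
  · rintro W ⟨hWE, -⟩ W' ⟨hW'E, -⟩ h
    have h1 : E' \ (E' \ W) = E' \ (E' \ W') := by simp only at h; rw [h]
    rwa [Set.sdiff_sdiff_cancel_left hWE, Set.sdiff_sdiff_cancel_left hW'E] at h1

end PercRepro
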